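import Mathlib
import Literature.MathematicalPhysics.QuantumFieldTheory.PottsGaugeWilsonLoopTopology
import HarnessLib

/-!
# The Euler–Poincaré relation for plaquette complexes on the torus (Duncan–Schweinhart, CMP 406
# (2025), Proposition 15, `i = 2`) and `dim H₂(P(ω)) = dim H²(P(ω))` — PROVED

Twelfth file of the transcription of the Fortuin–Kasteleyn-type representation of `q`-state Potts
lattice gauge theory (companions: `PlaquetteRandomCluster` — setting, readings (R1)–(R3) and the
SCOPE caveat: `ℤ_q`/Potts gauge theory only, nothing here bears on the Yang–Mills mass gap or on
`BalabanLadder.IR`; in the `ym` ladder only the conditional finite-`𝕋⁴` rung `BalabanLadder.UV` is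
closed by any route —, `PottsGaugeEdwardsSokal` (`bd₂ = δᵀ`, `pairing_bd₂`),
`PottsGaugeWilsonLoopTopology` (`plaqInd`, `res_td₁_eq_pairing_bd₂`)).

Source: P. Duncan, B. Schweinhart, *Topological phases in the plaquette random-cluster model and
Potts lattice gauge theory*, Comm. Math. Phys. **406** (2025), arXiv:2207.08339
[DuncanSchweinhart2025] (arXiv loci): §3, **Proposition 15** ("There is a constant
`c = c(N, i, d)` so that for any `i`-dimensional subcomplex `P` of `𝕋^d_N` containing the full
`(i-1)`-skeleton, `𝐛_i - 𝐛_{i-1} = η(P) + c`, where `η(P)` denotes the number of `i`-cells of `P`";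
proof by the Euler–Poincaré formula, eq. (5): "the presence or absence of `i`-cells can only affect
the Betti numbers in dimensions `i` and `i - 1`"), used as eq. (5) in the proof of Theorem 18
(duality): `(p/(1-p))^{η} q^{𝐛_{i-1}} = q^{c} (p/(q(1-p)))^{η} q^{𝐛_i}`; and §2.4 (cohomology with
field coefficients; universal coefficients `H_i(X; F) ≅ H^i(X; F)` for a field `F`).

We type `i = 2` on `X = 𝕋^d_L` in the cochain calculus of the companion files. Reading (R3) of
`PlaquetteRandomCluster` takes Betti numbers COHOMOLOGICALLY; accordingly
`b₂(P(ω); F) := dim_F H²(P(ω); F) = dim_F C²(P(ω))/δ(C¹)` (`P(ω)` has no `3`-cells, so every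
`2`-cochain on the open plaquettes is a cocycle). We ALSO prove that this equals the homological
`dim_F Z₂(P(ω); F) = dim_F H₂(P(ω); F)` (`2`-chains supported on `ω` with zero boundary; no
`3`-cells, so `B₂ = 0`) — the `i = 2` instance of the universal-coefficient identification the
source invokes (§2.4), here by `∂ = δᵀ` and `dim W + dim W^⊥ = dim C₂(ω)`.

## Contents (everything PROVED; no named fact)

* `coboundaryOn ω : C¹ →ₗ F^ω` (`δ` followed by restriction to the open plaquettes),
  `ker_coboundaryOn` (`= Z¹(P(ω))`), `CohomologyTwo`, `bettiTwo` (`b₂(P(ω); F)`);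
* **Proposition 15 (`i = 2`), PROVED**: `bettiTwo_add_finrank`
  (`b₂(P(ω)) + dim C¹(X) = b₁(P(ω)) + dim B¹(X) + |ω|`, i.e. `𝐛₂ - 𝐛₁ = η(P) + c` with
  `c = -(dim C¹ - dim B¹)` depending only on `d, L`), and its use as eq. (5):
  `weight_mul_pow_card` (`q^{|ω|} · w_{p,q}(ω) = q^{dim C¹ - dim B¹} · p^{|ω|}(1-p)^{|ωᶜ|} q^{b₂(ω)}`);
* `bd₂Lin` (the boundary `∂ : C₂ → C₁` as a linear map), `pairing_edgeInd_left`, `bd₂_eq_zero_iff`,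
  `twoCycles ω` (`Z₂(P(ω); F)`), **`finrank_twoCycles`** (`dim Z₂(P(ω); F) = b₂(P(ω); F)`:
  homological = cohomological second Betti number).
-/

open Finset Module

namespace Literature.MathematicalPhysics.QuantumFieldTheory

namespace PlaquetteRC

open LatticeForm

variable {d L : ℕ}

/-! ### `δ` restricted to the open plaquettes; `H²(P(ω))` and `b₂` -/

section Coboundary

variable (F : Type*) [Field F]

/-- `δ_ω : C¹(X; F) → F^ω`, `θ ↦ (δθ)|_ω`: the coboundary followed by restriction to the open
plaquettes of `ω` (the `2`-cells of `P(ω)`), so that `Z¹(P(ω)) = ker δ_ω` and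
`B²(P(ω)) = range δ_ω`. [cite: DuncanSchweinhart2025, §2.4 (cochains, δ) and §3 Prop. 15] -/
def coboundaryOn (ω : Finset (Plaquette d L)) : (Site d L → Fin d → F) →ₗ[F] (↥ω → F) where
  toFun θ σ := res (td₁ θ) σ.1
  map_add' a b := by
    funext σ
    simp only [res, td₁_add, Pi.add_apply]
  map_smul' c θ := by
    funext σ
    simp only [res, td₁_smul, Pi.smul_apply, RingHom.id_apply]

/-- `(δ_ω θ)(σ) = (δθ)(σ)`. [cite: DuncanSchweinhart2025, §2.4] -/
@[simp] theorem coboundaryOn_apply (ω : Finset (Plaquette d L)) (θ : Site d L → Fin d → F) (σ : ↥ω) :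
    coboundaryOn F ω θ σ = res (td₁ θ) σ.1 := rfl

/-- `ker δ_ω = Z¹(P(ω); F)`. [cite: DuncanSchweinhart2025, §5 (proof of Prop. 20: Z^{i-1}(P))] -/
theorem ker_coboundaryOn (ω : Finset (Plaquette d L)) :
    LinearMap.ker (coboundaryOn (d := d) (L := L) F ω) = flatCochains F F ω := by
  ext θ
  rw [LinearMap.mem_ker, mem_flatCochains]
  constructor
  · intro h p hp
    have := congrFun h ⟨p, hp⟩
    simpa using this
  · intro h
    funext σ
    simp [h σ.1 σ.2]

/-- `H²(P(ω); F) = C²(P(ω); F) / B²(P(ω); F) = F^ω / δ_ω(C¹)` (`P(ω)` has no `3`-cells, so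
`Z² = C²`). [cite: DuncanSchweinhart2025, §2.4 (H^i = Z^i/B^i)] -/
abbrev CohomologyTwo (ω : Finset (Plaquette d L)) : Type _ :=
  (↥ω → F) ⧸ LinearMap.range (coboundaryOn (d := d) (L := L) F ω)

/-- The second Betti number `b₂(P(ω); F) = dim_F H²(P(ω); F)` (cohomological, reading R3; equal to
the homological `dim_F H₂(P(ω); F)` by `finrank_twoCycles`). [cite: DuncanSchweinhart2025, §3 Prop. 15 (𝐛_i)] -/
noncomputable def bettiTwo (ω : Finset (Plaquette d L)) : ℕ := finrank F (CohomologyTwo F ω)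

variable [NeZero L]

/-- `b₂(P(ω)) + dim B²(P(ω)) = |ω|` (rank–nullity for the quotient `H² = C²/B²`,
`dim C²(P(ω)) = |ω|`). [cite: DuncanSchweinhart2025, §3 Prop. 15 (proof: Euler–Poincaré)] -/
theorem bettiTwo_add_finrank_range (ω : Finset (Plaquette d L)) :
    bettiTwo F ω + finrank F (LinearMap.range (coboundaryOn (d := d) (L := L) F ω)) = ω.card := by
  unfold bettiTwo CohomologyTwo
  rw [Submodule.finrank_quotient_add_finrank, Module.finrank_fintype_fun_eq_card, Fintype.card_coe]

/-- **Proposition 15 (Euler–Poincaré), `i = 2`, on the torus `𝕋^d_L`, PROVED:**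
`b₂(P(ω)) + dim C¹(𝕋) = b₁(P(ω)) + dim B¹(𝕋) + |ω|`, i.e. `𝐛₂ - 𝐛₁ = η(P(ω)) + c` with the
constant `c = -(dim_F C¹(𝕋^d_L) - dim_F B¹(𝕋^d_L))` depending only on `d` and `L`. Proof:
rank–nullity for `δ_ω` (`dim C¹ = dim Z¹(P(ω)) + dim B²(P(ω))`), `dim Z¹ = b₁ + dim B¹` and
`dim B² = |ω| - b₂`. [cite: DuncanSchweinhart2025, §3 Prop. 15] -/
theorem bettiTwo_add_finrank (ω : Finset (Plaquette d L)) :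
    bettiTwo F ω + finrank F (Site d L → Fin d → F) =
      bettiOne F ω + finrank F (gradCochains (d := d) (L := L) F F) + ω.card := by
  have h1 := LinearMap.finrank_range_add_finrank_ker (coboundaryOn (d := d) (L := L) F ω)
  rw [ker_coboundaryOn] at h1
  have h2 := bettiTwo_add_finrank_range F ω
  have h3 := bettiOne_add_finrank_grad F ω
  omega

/-- **Eq. (5) of the proof of Theorem 18 (the use of Proposition 15 in the weights), PROVED:**
`q^{|ω|} · p^{|ω|}(1-p)^{|ωᶜ|} q^{b₁(P(ω))} = q^{dim C¹ - dim B¹} · p^{|ω|}(1-p)^{|ωᶜ|} q^{b₂(P(ω))}`,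
i.e. the plaquette random-cluster weight can be written with the TOP Betti number at the price of
the factor `q^{-|ω|}` and a constant. [cite: DuncanSchweinhart2025, Thm. 18 (proof, step "by (5)")] -/
theorem weight_mul_pow_card (p q : ℝ) (ω : Finset (Plaquette d L)) :
    weight F p q ω * q ^ ω.card =
      q ^ (finrank F (Site d L → Fin d → F) - finrank F (gradCochains (d := d) (L := L) F F)) *
        (p ^ ω.card * (1 - p) ^ ωᶜ.card * q ^ bettiTwo F ω) := by
  have h := bettiTwo_add_finrank (d := d) (L := L) F ω
  have hle : finrank F (gradCochains (d := d) (L := L) F F) ≤ finrank F (Site d L → Fin d → F) :=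
    Submodule.finrank_le _
  have hexp : bettiOne F ω + ω.card =
      (finrank F (Site d L → Fin d → F) - finrank F (gradCochains (d := d) (L := L) F F)) +
        bettiTwo F ω := by omega
  unfold weight
  calc p ^ ω.card * (1 - p) ^ ωᶜ.card * q ^ bettiOne F ω * q ^ ω.card
      = p ^ ω.card * (1 - p) ^ ωᶜ.card * q ^ (bettiOne F ω + ω.card) := by rw [pow_add]; ring
    _ = p ^ ω.card * (1 - p) ^ ωᶜ.card *
          q ^ ((finrank F (Site d L → Fin d → F) - finrank F (gradCochains (d := d) (L := L) F F)) +
            bettiTwo F ω) := by rw [hexp]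
    _ = _ := by rw [pow_add]; ring

end Coboundary

/-! ### `Z₂(P(ω); F)` and `dim H₂ = dim H²` -/

section TwoCycles

variable (F : Type*) [Field F]

/-- The annihilator of `B²(P(ω)) = δ_ω(C¹)` in `F^ω` under the standard dot product: the chains on
the open plaquettes orthogonal to all restricted coboundaries. [cite: DuncanSchweinhart2025, §2.4 (duality between chains and cochains)] -/
def rangeOrth (ω : Finset (Plaquette d L)) : Submodule F (↥ω → F) :=
  (LinearMap.range (coboundaryOn (d := d) (L := L) F ω)).dualAnnihilator.comap
    (dotProductEquiv F ↥ω).toLinearMap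

/-- Membership in the annihilator: `c ⟂ δ_ω θ` for all `θ`. [cite: DuncanSchweinhart2025, §2.4] -/
theorem mem_rangeOrth {ω : Finset (Plaquette d L)} {c : ↥ω → F} :
    c ∈ rangeOrth F ω ↔ ∀ θ : Site d L → Fin d → F, dotProduct c (coboundaryOn F ω θ) = 0 := by
  unfold rangeOrth
  rw [Submodule.mem_comap, Submodule.mem_dualAnnihilator]
  constructor
  · intro h θ
    have := h _ (LinearMap.mem_range_self _ θ)
    simpa using this
  · intro h w hw
    obtain ⟨θ, rfl⟩ := LinearMap.mem_range.mp hw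
    simpa using h θ

variable [NeZero L]

/-- The boundary `∂ : C₂ → C₁` (`bd₂`, the transpose of `δ`) as an `F`-linear map.
[cite: DuncanSchweinhart2025, §2.1 (∂) and §1.1 Def. 2 (δf(σ) = f(∂σ))] -/
def bd₂Lin : (Plaquette d L → F) →ₗ[F] (Site d L → Fin d → F) where
  toFun := bd₂
  map_add' a b := by
    funext x k
    simp only [bd₂, Pi.add_apply, add_mul, Finset.sum_add_distrib]
  map_smul' r a := by
    funext x k
    simp only [bd₂, Pi.smul_apply, smul_eq_mul, RingHom.id_apply, Finset.mul_sum, mul_assoc]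

/-- `bd₂Lin` is `bd₂`. [cite: DuncanSchweinhart2025, §2.1] -/
@[simp] theorem bd₂Lin_apply (c : Plaquette d L → F) : bd₂Lin (d := d) (L := L) F c = bd₂ c := rfl

/-- `⟨𝟙_e, γ⟩ = γ(e)`: the pairing with an edge indicator evaluates the chain (non-degeneracy of the
chain–cochain pairing in the cell basis). [cite: DuncanSchweinhart2025, §2.4 (cochains as the dual of chains)] -/
theorem pairing_edgeInd_left (x : Site d L) (k : Fin d) (γ : Site d L → Fin d → F) :
    pairing (edgeInd (R := F) x k) γ = γ x k := by
  unfold pairing edgeInd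
  simp only [ite_mul, one_mul, zero_mul]
  rw [Finset.sum_eq_single x]
  · rw [Finset.sum_eq_single k]
    · simp
    · intro l _ hl; rw [if_neg (fun h => hl h.2)]
    · intro h; exact absurd (Finset.mem_univ k) h
  · intro y _ hy; exact Finset.sum_eq_zero fun l _ => by rw [if_neg (fun h => hy h.1)]
  · intro h; exact absurd (Finset.mem_univ x) h

/-- `∂c = 0` iff `⟨δθ, c⟩ = 0` for every `1`-cochain `θ` (`∂ = δᵀ` and non-degeneracy of the
pairing). [cite: DuncanSchweinhart2025, §1.1 Def. 2 (δf(σ) = f(∂σ))] -/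
theorem bd₂_eq_zero_iff (c : Plaquette d L → F) :
    bd₂ c = 0 ↔ ∀ θ : Site d L → Fin d → F, pairing₂ (res (td₁ θ)) c = 0 := by
  constructor
  · intro h θ
    rw [← pairing_bd₂, h]
    unfold pairing
    simp
  · intro h
    funext x k
    rw [Pi.zero_apply, ← pairing_edgeInd_left F x k (bd₂ c), pairing_bd₂]
    exact h _

/-- `Z₂(P(ω); F)`: the `2`-chains supported on the open plaquettes with zero boundary; since
`P(ω)` has no `3`-cells, `Z₂(P(ω); F) = H₂(P(ω); F)` and its dimension is the homological
`𝐛₂(P(ω))` of Definition 1 / Prop. 15. [cite: DuncanSchweinhart2025, §2.1 (Z_i, H_i) and §3 Prop. 15] -/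
def twoCycles (ω : Finset (Plaquette d L)) : Submodule F (Plaquette d L → F) where
  carrier := {z | (∀ σ, σ ∉ ω → z σ = 0) ∧ bd₂ z = 0}
  add_mem' := by
    rintro a b ⟨ha, ha0⟩ ⟨hb, hb0⟩
    refine ⟨fun σ hσ => by rw [Pi.add_apply, ha σ hσ, hb σ hσ, add_zero], ?_⟩
    have := (bd₂Lin (d := d) (L := L) F).map_add a b
    simp only [bd₂Lin_apply] at this
    rw [this, ha0, hb0, add_zero]
  zero_mem' := by
    refine ⟨fun _ _ => rfl, ?_⟩
    have := (bd₂Lin (d := d) (L := L) F).map_zero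
    simpa using this
  smul_mem' := by
    rintro r a ⟨ha, ha0⟩
    refine ⟨fun σ hσ => by rw [Pi.smul_apply, ha σ hσ, smul_zero], ?_⟩
    have := (bd₂Lin (d := d) (L := L) F).map_smul r a
    simp only [bd₂Lin_apply] at this
    rw [this, ha0, smul_zero]

/-- Membership in `Z₂(P(ω); F)`. [cite: DuncanSchweinhart2025, §2.1] -/
theorem mem_twoCycles {ω : Finset (Plaquette d L)} {z : Plaquette d L → F} :
    z ∈ twoCycles F ω ↔ (∀ σ, σ ∉ ω → z σ = 0) ∧ bd₂ z = 0 := Iff.rfl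

/-- `dim (B²)^⊥ = |ω| - dim B² = b₂(P(ω))`. [cite: DuncanSchweinhart2025, §2.4 and §3 Prop. 15] -/
theorem finrank_rangeOrth (ω : Finset (Plaquette d L)) : finrank F (rangeOrth F ω) = bettiTwo F ω := by
  have h1 := Subspace.finrank_add_finrank_dualAnnihilator_eq
    (LinearMap.range (coboundaryOn (d := d) (L := L) F ω))
  have h2 := bettiTwo_add_finrank_range (d := d) (L := L) F ω
  have h3 : finrank F (rangeOrth F ω) =
      finrank F (LinearMap.range (coboundaryOn (d := d) (L := L) F ω)).dualAnnihilator := by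
    unfold rangeOrth
    exact (Submodule.comap_equiv_eq_map_symm (dotProductEquiv F ↥ω)
      (LinearMap.range (coboundaryOn (d := d) (L := L) F ω)).dualAnnihilator) ▸
      LinearEquiv.finrank_map_eq _ _
  rw [Module.finrank_fintype_fun_eq_card, Fintype.card_coe] at h1
  omega

/-- For a chain `z` supported on `ω`: `∂z = 0` iff its restriction to `ω` is orthogonal to
`δ_ω(C¹)`. [cite: DuncanSchweinhart2025, §1.1 Def. 2 (δf(σ) = f(∂σ))] -/
theorem bd₂_eq_zero_iff_restrict_mem {ω : Finset (Plaquette d L)} {z : Plaquette d L → F}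
    (hz : ∀ σ, σ ∉ ω → z σ = 0) :
    bd₂ z = 0 ↔ (fun σ : ↥ω => z σ.1) ∈ rangeOrth F ω := by
  rw [bd₂_eq_zero_iff, mem_rangeOrth]
  have hsum : ∀ θ : Site d L → Fin d → F,
      dotProduct (fun σ : ↥ω => z σ.1) (coboundaryOn F ω θ) = pairing₂ (res (td₁ θ)) z := by
    intro θ
    unfold dotProduct pairing₂
    simp only [coboundaryOn_apply]
    rw [show (∑ σ : ↥ω, z σ.1 * res (td₁ θ) σ.1) = ∑ σ ∈ ω, z σ * res (td₁ θ) σ from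
      Finset.sum_coe_sort ω (fun σ => z σ * res (td₁ θ) σ)]
    rw [Finset.sum_subset (Finset.subset_univ ω)]
    · exact Finset.sum_congr rfl fun σ _ => mul_comm _ _
    · intro σ _ hσ
      rw [hz σ hσ, zero_mul]
  simp_rw [hsum]

/-- `Z₂(P(ω); F) ≃ (B²(P(ω)))^⊥ ⊆ F^ω` by restriction to the open plaquettes.
[cite: DuncanSchweinhart2025, §2.4 (H_i(X;F) ≅ H^i(X;F) for field coefficients)] -/
noncomputable def twoCyclesEquiv (ω : Finset (Plaquette d L)) : twoCycles F ω ≃ₗ[F] rangeOrth F ω := by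
  classical
  exact
  { toFun := fun z => ⟨fun σ => z.1 σ.1, (bd₂_eq_zero_iff_restrict_mem F z.2.1).mp z.2.2⟩
    map_add' := fun a b => by ext σ; rfl
    map_smul' := fun r a => by ext σ; rfl
    invFun := fun c =>
      have hsupp : ∀ σ, σ ∉ ω → (fun τ => if h : τ ∈ ω then c.1 ⟨τ, h⟩ else (0 : F)) σ = 0 :=
        fun σ hσ => by simp [hσ]
      ⟨fun σ => if h : σ ∈ ω then c.1 ⟨σ, h⟩ else 0, by
        refine ⟨hsupp, ?_⟩
        rw [bd₂_eq_zero_iff_restrict_mem F hsupp]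
        have : (fun σ : ↥ω => (fun τ => if h : τ ∈ ω then c.1 ⟨τ, h⟩ else (0 : F)) σ.1) = c.1 := by
          funext σ; simp [σ.2]
        rw [this]; exact c.2⟩
    left_inv := fun z => by
      apply Subtype.ext
      funext σ
      by_cases h : σ ∈ ω
      · simp [h]
      · simp [h, z.2.1 σ h]
    right_inv := fun c => by
      apply Subtype.ext
      funext σ
      simp [σ.2] }

/-- **`dim_F Z₂(P(ω); F) = b₂(P(ω); F)`: the homological and the cohomological second Betti numbers
of the plaquette complex agree, PROVED** (`P(ω)` has no `3`-cells; `∂ = δᵀ`; `dim W + dim W^⊥ = |ω|`).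
This is the `i = 2` case of the universal-coefficient identification `H_i(X;F) ≅ H^i(X;F)` used
by the source (§2.4) and justifies reading (R3) for the top Betti number of Proposition 15.
[cite: DuncanSchweinhart2025, §2.4 and §3 Prop. 15] -/
theorem finrank_twoCycles (ω : Finset (Plaquette d L)) : finrank F (twoCycles F ω) = bettiTwo F ω := by
  rw [(twoCyclesEquiv (d := d) (L := L) F ω).finrank_eq, finrank_rangeOrth]

/-- **Proposition 15 in the source's homological normalisation, PROVED:**
`dim Z₂(P(ω)) + dim C¹(𝕋) = b₁(P(ω)) + dim B¹(𝕋) + |ω|`. [cite: DuncanSchweinhart2025, §3 Prop. 15] -/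
theorem finrank_twoCycles_add_finrank (ω : Finset (Plaquette d L)) :
    finrank F (twoCycles F ω) + finrank F (Site d L → Fin d → F) =
      bettiOne F ω + finrank F (gradCochains (d := d) (L := L) F F) + ω.card := by
  rw [finrank_twoCycles, bettiTwo_add_finrank]

end TwoCycles

end PlaquetteRC

end Literature.MathematicalPhysics.QuantumFieldTheory
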